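import Summits.QuantumFields.BalabanUV.Beta.FP.LegRemainderGaugeTerm
import Summits.QuantumFields.BalabanUV.Beta.FP.SliceLoopWindowLetters

/-!
# `BalabanUV.Beta.FP.LegRemainderConstraintTerm` — road «FP» (binder row D1), organisation γ, **THE (R1) CONSTRAINT-TERM POWER COUNTING**
# (owner NOTE R-γ-18 (i) → leaf-05, journal l.30741; INTENT 2, journal): RHOA-3's four windowed `R`-letters `B·n^{−2−j}` (j ≤ 2) for the constraint term
# `R₂ = P·Qᵀ·𝓘ᴸ` of `FP/SlicePairing.legRem_eq` (R1) from THREE leg letters — a QUADRATIC translation-invariant leg (CUBIC once differenced), BOUNDED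
# BLOCK-SUPPORTED averaging weights, and an exponentially localised coarse × fine leg — the sibling of `FP/LegRemainderGaugeTerm` ([folklore] real analysis
# on `ℤ⁴`; no road object is typed or touched)

HONEST DEPENDENCY (page 1, mandatory): continuum YM on T⁴ ⇐ BetaPertH ∧ nine spine estimates (0/9 proved); BetaPertH ⇐ (D1) ∧ (D4) ∧
CAP+tail; G-an2-4 gates asym, D1 and NE2/3/4.  HONEST FRAMING (cell contract, verbatim): «discharging `BetaPertH` makes Bałaban's UV
stability UNCONDITIONAL — a real constructive-QFT result; it is NOT the continuum limit and NOT the Clay problem.»  THIS MODULE is elementary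
[folklore] real analysis on `ℤ⁴ = DyadicShell.Pt` over the tree's window sums (`SliceLoopWindowLetters.sum_box_inv_sq_le`, `GhostLoopCountingWindow.sum_box_inv_cube_le`,
`Literature.Probability.LatticeModels.card_box`) and the sibling's `LegRemainderGaugeTerm.sum_range_exp_le` BY NAME; every analytic input (the three legs'
letters) is a HYPOTHESIS displayed in the signatures.  It cites nothing, defines nothing, mints no `Prop` fact, 0 sorry.  It is NOT the road instance (the
legs `P = Pker`∕`Pkerˢˢ` with its letters `PerfectPropagatorLegData`, `Qᵀ` = the `n`-block contour weights of `OneStepKernelFamily.dec`, `𝓘ᴸ = minOpL` with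
GAMMA-1's letters are the OWNER's ∕ an2 W-4 (ii)'s; the identification of the END's `R m` with the (R1) sum is the owner's located conjecture R-γ-18 (ii)),
NOT the gauge term (the sibling file), NOT (pp)∕(rem) for any road piece, NOT hslice, NOT (ASYMP), NOT D1, NOT BetaPertH, NOT continuum, NOT Clay.

ABSOLUTE RULE (cell charter, verbatim): «No internally-minted statement may enter as a cited fact. Every hypothesis is either kernel-proved in this
package or a verbatim quotation of a PUBLISHED theorem with page reference. The manuscript(s) under audit are NOT citable for their own disputed
steps — they are the thing under adjudication; programme-internal (2001/route/tribunal) claims are never citable.»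

WHY ∕ THE PLACEMENT (L-d1leaf05g18-1 continued).  In `R₂(b,w) = Σ_B [Σ_x P(b−x)·Qᵀ(x,B)]·𝓘ᴸ(B,w)` the `b`-difference sits on the translation-invariant
leg `P` (quadratic letter `A₀∕(‖z‖∞+1)²`, differenced leg cubic `A₁∕(‖z‖∞+1)³` — one power better, no reindexing needed), the `w`-difference on the coarse
leg's fine variable (`ι₁`, on the road `≍ ι₀∕n`), and the averaging weights are bounded (`ω₀`, road `n^{−4}`) and supported in a box of radius `Rω` (road `2n`)
about a centre `γ B` (road `n•B`).  POWER COUNT (log-free): the `P ∘ Qᵀ` leg is `≤ A·ω₀·721(Rω+1)²` (quadratic) resp. `≤ A·ω₀·241(Rω+1)` (cubic) UNIFORMLY in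
`(b, B)` (`sum_shifted_box_inv_sq_le` ∕ `_cube_le`: a box of radius `R` with ANY centre), and the coarse sum `Σ_B e^{−κ‖B − β w‖∞} ≤ 1 + 7680∕κ⁴` (`sum_exp_coarse_le`);
`(B₀,B₁,B₁′,B₂) = (1+7680∕κ⁴)·ω₀·(721A₀(Rω+1)²ι₀, 241A₁(Rω+1)ι₀, 721A₀(Rω+1)²ι₁, 241A₁(Rω+1)ι₁) ≍ (n^{−2}, n^{−3}, n^{−3}, n^{−4})` — RHOA-3's shape.

CONTENT (`F : Pt → ℝ` translation-invariant leg, `ω : Pt → Pt → ℝ` weights (fine `x`, coarse label `B`), `I : Pt → Pt → ℝ` coarse × fine leg; `γ β : Pt → Pt`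
the centre ∕ block maps — ANY maps; `0 < κ`).  §1 `sum_shifted_box_inv_sq_le`, `sum_shifted_box_inv_cube_le`, `sum_exp_coarse_le`; §2 `sum_leg_weight_le_sq` ∕ `_cube`
(the `P ∘ Qᵀ` leg, uniform in the centres); §3 `sum_three_le` (finite-partial-sum currency), `summable_three`, `abs_tsum_three_le`; §4 THE FOUR RHOA-3 LETTERS for
`ρ₂ b w := Σ'_{(x,B)} F(b−x)·ω x B·I B w`: `abs_rho₂_le`, `abs_rho₂_sub_left_le`, `abs_rho₂_sub_right_le`, `abs_rho₂_sub_sub_le`.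
Unit `b2b-balaban-beta-d1-formalise-leaf-05` (gen 18; D1 formalisation swarm leaf seat, road FP lane IR-5′), 2026-08-21; `LEAVES-FP.md` row «(R1) CONSTRAINT-TERM
POWER COUNTING».  «not in print; our bookkeeping».
-/

noncomputable section

namespace Summit.QuantumFields.BalabanUV.Beta.FP.LegRemainderConstraintTerm

open Finset Real
open scoped BigOperators
open Literature.Probability.LatticeModels (box annulus zero_mem_box card_box)
open Literature.MathematicalPhysics.QuantumFieldTheory.Balaban1983to89.Beta
open Literature.MathematicalPhysics.QuantumFieldTheory.Balaban1983to89.Beta.TransferUV (card_annulus_succ_four_le)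
open DyadicShell (Pt supNorm mem_box_iff mem_annulus_iff supNorm_le_iff supNorm_eq_of_mem_sphere sum_Ico_shellSum supNorm_eq_zero_iff)
open Summit.QuantumFields.BalabanUV.Beta.FP.NearRegionCrossBubble (sum_annulus_le_of_shell_bound)
open Summit.QuantumFields.BalabanUV.Beta.FP.BlockAveragedKernel (sum_box_eq_add_sum_annulus supNorm_add_le_nat)
open Summit.QuantumFields.BalabanUV.Beta.FP.GhostLoopCountingWindow (sum_box_inv_cube_le)
open Summit.QuantumFields.BalabanUV.Beta.FP.SliceLoopWindowLetters (sum_box_inv_sq_le)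
open Summit.QuantumFields.BalabanUV.Beta.FP.LegRemainderGaugeTerm (sum_range_exp_le)
open GradedBubbles (supNorm_neg)

/-! ## §1 Window sums with an arbitrary centre, and the coarse exponential sum -/

/-- [folklore] **A BOX OF RADIUS `R` WITH ANY CENTRE against an inverse power `m ≤ 4`**: if `‖c‖∞ ≤ 2R` the box lies in `box 4 (3R)` (use the centred bound `W`);
otherwise every point of it has `‖z‖∞ ≥ R + 1` and there are `(2R+1)⁴ ≤ 16(R+1)⁴` of them — in both cases `≤ W + 16(R+1)^{4−m}`. -/
theorem sum_shifted_box_le {m : ℕ} (hm : m ≤ 4) {W : ℝ} (R : ℕ) (c : Pt)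
    (hW : ∑ z ∈ box 4 (3 * R), (((supNorm z : ℝ) + 1) ^ m)⁻¹ ≤ W) (X : Finset Pt) (hX : ∀ z ∈ X, supNorm (z - c) ≤ R) :
    ∑ z ∈ X, (((supNorm z : ℝ) + 1) ^ m)⁻¹ ≤ W + 16 * ((R : ℝ) + 1) ^ (4 - m) := by
  classical
  have hW0 : 0 ≤ W := le_trans (Finset.sum_nonneg fun z _ => by positivity) hW
  have h16 : 0 ≤ 16 * ((R : ℝ) + 1) ^ (4 - m) := by positivity
  rcases le_or_gt (supNorm c) (2 * R) with hc | hc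
  · -- near centre: `X ⊆ box 4 (3R)`
    have hsub : X ⊆ box 4 (3 * R) := fun z hz => by
      rw [mem_box_iff]
      have h1 := supNorm_add_le_nat (z - c) c
      rw [sub_add_cancel] at h1
      have := hX z hz
      omega
    calc ∑ z ∈ X, (((supNorm z : ℝ) + 1) ^ m)⁻¹ ≤ ∑ z ∈ box 4 (3 * R), (((supNorm z : ℝ) + 1) ^ m)⁻¹ :=
          Finset.sum_le_sum_of_subset_of_nonneg hsub fun z _ _ => by positivity
      _ ≤ W + 16 * ((R : ℝ) + 1) ^ (4 - m) := hW.trans (le_add_of_nonneg_right h16)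
  · -- far centre: every term `≤ ((R+1)^m)⁻¹`, at most `(2R+1)⁴` terms
    have hterm : ∀ z ∈ X, (((supNorm z : ℝ) + 1) ^ m)⁻¹ ≤ (((R : ℝ) + 1) ^ m)⁻¹ := by
      intro z hz
      have h1 := supNorm_add_le_nat (c - z) z
      rw [sub_add_cancel] at h1
      have h2 : supNorm (c - z) ≤ R := by rw [← supNorm_neg, neg_sub]; exact hX z hz
      have hRz : (R : ℝ) + 1 ≤ (supNorm z : ℝ) + 1 := by
        have h3 : R + 1 ≤ supNorm z := by omega
        have h4 : ((R + 1 : ℕ) : ℝ) ≤ (supNorm z : ℝ) := by exact_mod_cast h3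
        push_cast at h4; linarith
      exact inv_anti₀ (by positivity) (pow_le_pow_left₀ (by positivity) hRz m)
    have hcard : (X.card : ℝ) ≤ ((2 * R + 1 : ℕ) : ℝ) ^ 4 := by
      have hsub : X ⊆ (box 4 R).image (fun z => z + c) := fun z hz =>
        Finset.mem_image.mpr ⟨z - c, mem_box_iff.mpr (hX z hz), sub_add_cancel z c⟩
      have h1 := Finset.card_le_card hsub
      have h2 := Finset.card_image_le (s := box 4 R) (f := fun z => z + c)
      rw [card_box] at h2
      exact_mod_cast h1.trans h2
    calc ∑ z ∈ X, (((supNorm z : ℝ) + 1) ^ m)⁻¹ ≤ ∑ _z ∈ X, (((R : ℝ) + 1) ^ m)⁻¹ := Finset.sum_le_sum hterm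
      _ = (X.card : ℝ) * (((R : ℝ) + 1) ^ m)⁻¹ := by rw [Finset.sum_const, nsmul_eq_mul]
      _ ≤ ((2 * R + 1 : ℕ) : ℝ) ^ 4 * (((R : ℝ) + 1) ^ m)⁻¹ := mul_le_mul_of_nonneg_right hcard (by positivity)
      _ ≤ (2 * ((R : ℝ) + 1)) ^ 4 * (((R : ℝ) + 1) ^ m)⁻¹ := by
          refine mul_le_mul_of_nonneg_right (pow_le_pow_left₀ (by positivity) ?_ 4) (by positivity)
          push_cast; linarith
      _ = 16 * ((R : ℝ) + 1) ^ (4 - m) := by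
          have hR1 : ((R : ℝ) + 1) ≠ 0 := by positivity
          rw [pow_sub₀ _ hR1 hm, mul_pow]; ring
      _ ≤ W + 16 * ((R : ℝ) + 1) ^ (4 - m) := le_add_of_nonneg_left hW0

/-- [folklore] **QUADRATIC, any centre**: `Σ_{‖z−c‖∞ ≤ R} ((‖z‖∞+1)²)⁻¹ ≤ 721(R+1)² + 16(R+1)² = 737(R+1)²` (crudely; from `sum_box_inv_sq_le (3R) ≤ 1 + 720R²`). -/
theorem sum_shifted_box_inv_sq_le (R : ℕ) (c : Pt) (X : Finset Pt) (hX : ∀ z ∈ X, supNorm (z - c) ≤ R) :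
    ∑ z ∈ X, (((supNorm z : ℝ) + 1) ^ 2)⁻¹ ≤ 737 * ((R : ℝ) + 1) ^ 2 := by
  have hW : ∑ z ∈ box 4 (3 * R), (((supNorm z : ℝ) + 1) ^ 2)⁻¹ ≤ 721 * ((R : ℝ) + 1) ^ 2 := by
    refine (sum_box_inv_sq_le (3 * R)).trans ?_
    have hR : (0 : ℝ) ≤ R := Nat.cast_nonneg R
    push_cast; nlinarith
  have h := sum_shifted_box_le (m := 2) (by norm_num) R c hW X hX
  norm_num at h
  linarith

/-- [folklore] **CUBIC, any centre**: `Σ_{‖z−c‖∞ ≤ R} ((‖z‖∞+1)³)⁻¹ ≤ 241(R+1) + 16(R+1) = 257(R+1)`. -/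
theorem sum_shifted_box_inv_cube_le (R : ℕ) (c : Pt) (X : Finset Pt) (hX : ∀ z ∈ X, supNorm (z - c) ≤ R) :
    ∑ z ∈ X, (((supNorm z : ℝ) + 1) ^ 3)⁻¹ ≤ 257 * ((R : ℝ) + 1) := by
  have hW : ∑ z ∈ box 4 (3 * R), (((supNorm z : ℝ) + 1) ^ 3)⁻¹ ≤ 241 * ((R : ℝ) + 1) := by
    refine (sum_box_inv_cube_le (3 * R)).trans ?_
    have hR : (0 : ℝ) ≤ R := Nat.cast_nonneg R
    push_cast; nlinarith
  have h := sum_shifted_box_le (m := 3) (by norm_num) R c hW X hX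
  norm_num at h
  linarith

/-- [folklore] **THE COARSE EXPONENTIAL SUM**: `Σ_{B∈𝔅} e^{−κ‖B − c‖∞} ≤ 1 + 7680∕κ⁴` for every finite `𝔅 ⊂ ℤ⁴`, every centre `c`, `κ > 0`
(shells `#{‖z‖∞ = s} ≤ 80s³`, `s³ ≤ 6·(2∕κ)³·e^{(κ∕2)s}` from `Real.pow_div_factorial_le_exp`, then the geometric tail `Σ_{s≥1} e^{−(κ∕2)s} ≤ 2∕κ`). -/
theorem sum_exp_coarse_le {κ : ℝ} (hκ : 0 < κ) (c : Pt) (Bs : Finset Pt) :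
    ∑ B ∈ Bs, Real.exp (-(κ * (supNorm (B - c) : ℝ))) ≤ 1 + 7680 / κ ^ 4 := by
  classical
  -- reindex by `z = B − c`
  have hinj : Set.InjOn (fun B : Pt => B - c) Bs := fun a _ b _ h => by simpa using h
  rw [← Finset.sum_image (f := fun z : Pt => Real.exp (-(κ * (supNorm z : ℝ)))) hinj]
  set Z := Bs.image (fun B : Pt => B - c)
  set R := Z.sup supNorm
  have hsub : Z ⊆ box 4 R := fun z hz => mem_box_iff.mpr (Finset.le_sup (f := supNorm) hz)
  refine (Finset.sum_le_sum_of_subset_of_nonneg hsub fun z _ _ => (Real.exp_pos _).le).trans ?_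
  rw [sum_box_eq_add_sum_annulus]
  rw [show Real.exp (-(κ * (supNorm (0 : Pt) : ℝ))) = 1 by rw [supNorm_eq_zero_iff.mpr rfl]; simp]
  refine add_le_add le_rfl ?_
  have ht : 0 < κ / 2 := by positivity
  have hshell := sum_annulus_le_of_shell_bound (g := fun z => Real.exp (-(κ * (supNorm z : ℝ))))
    (φ := fun r => Real.exp (-(κ * ((r : ℝ) + 1)))) (fun r => (Real.exp_pos _).le)
    (fun r w hw => by
      have hs : (supNorm w : ℝ) = (r : ℝ) + 1 := by exact_mod_cast supNorm_eq_of_mem_sphere hw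
      simp only [hs]; exact le_rfl) R
  refine hshell.trans ?_
  -- `80(r+1)³e^{−κ(r+1)} ≤ (80·48∕κ³)·e^{−(κ∕2)(r+1)}`
  have hstep : ∀ r : ℕ, 80 * ((r : ℝ) + 1) ^ 3 * Real.exp (-(κ * ((r : ℝ) + 1))) ≤ (3840 / κ ^ 3) * Real.exp (-(κ / 2 * ((r : ℝ) + 1))) := by
    intro r
    have hx : 0 ≤ κ / 2 * ((r : ℝ) + 1) := by positivity
    have hcube : (κ / 2 * ((r : ℝ) + 1)) ^ 3 / (Nat.factorial 3) ≤ Real.exp (κ / 2 * ((r : ℝ) + 1)) :=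
      Real.pow_div_factorial_le_exp _ hx 3
    rw [show (Nat.factorial 3 : ℝ) = 6 by norm_num] at hcube
    have hκ3 : 0 < κ ^ 3 := by positivity
    -- `(r+1)³ = (2/κ)³ (κ/2 (r+1))³ ≤ (8/κ³)·6·e^{(κ/2)(r+1)}`
    have h1 : ((r : ℝ) + 1) ^ 3 ≤ 48 / κ ^ 3 * Real.exp (κ / 2 * ((r : ℝ) + 1)) := by
      have e1 : ((r : ℝ) + 1) ^ 3 = 8 / κ ^ 3 * (κ / 2 * ((r : ℝ) + 1)) ^ 3 := by field_simp; ring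
      rw [e1]
      calc 8 / κ ^ 3 * (κ / 2 * ((r : ℝ) + 1)) ^ 3 = 8 / κ ^ 3 * 6 * ((κ / 2 * ((r : ℝ) + 1)) ^ 3 / 6) := by ring
        _ ≤ 8 / κ ^ 3 * 6 * Real.exp (κ / 2 * ((r : ℝ) + 1)) := mul_le_mul_of_nonneg_left hcube (by positivity)
        _ = _ := by ring
    have e2 : Real.exp (-(κ * ((r : ℝ) + 1))) = Real.exp (-(κ / 2 * ((r : ℝ) + 1))) * Real.exp (-(κ / 2 * ((r : ℝ) + 1))) := by
      rw [← Real.exp_add]; ring_nf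
    have e3 : Real.exp (κ / 2 * ((r : ℝ) + 1)) * Real.exp (-(κ / 2 * ((r : ℝ) + 1))) = 1 := by
      rw [← Real.exp_add, add_neg_cancel, Real.exp_zero]
    calc 80 * ((r : ℝ) + 1) ^ 3 * Real.exp (-(κ * ((r : ℝ) + 1)))
        ≤ 80 * (48 / κ ^ 3 * Real.exp (κ / 2 * ((r : ℝ) + 1))) * Real.exp (-(κ * ((r : ℝ) + 1))) :=
          mul_le_mul_of_nonneg_right (mul_le_mul_of_nonneg_left h1 (by norm_num)) (Real.exp_pos _).le
      _ = (3840 / κ ^ 3) * Real.exp (-(κ / 2 * ((r : ℝ) + 1))) := by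
          rw [e2]
          calc 80 * (48 / κ ^ 3 * Real.exp (κ / 2 * ((r : ℝ) + 1)))
                * (Real.exp (-(κ / 2 * ((r : ℝ) + 1))) * Real.exp (-(κ / 2 * ((r : ℝ) + 1))))
              = 3840 / κ ^ 3 * (Real.exp (κ / 2 * ((r : ℝ) + 1)) * Real.exp (-(κ / 2 * ((r : ℝ) + 1))))
                  * Real.exp (-(κ / 2 * ((r : ℝ) + 1))) := by ring
            _ = _ := by rw [e3, mul_one]
  calc ∑ r ∈ Finset.range R, 80 * ((r : ℝ) + 1) ^ 3 * Real.exp (-(κ * ((r : ℝ) + 1)))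
      ≤ ∑ r ∈ Finset.range R, (3840 / κ ^ 3) * Real.exp (-(κ / 2 * ((r : ℝ) + 1))) := Finset.sum_le_sum fun r _ => hstep r
    _ = (3840 / κ ^ 3) * ∑ r ∈ Finset.range R, Real.exp (-(κ / 2 * ((r : ℝ) + 1))) := by rw [Finset.mul_sum]
    _ ≤ (3840 / κ ^ 3) * (1 / (κ / 2)) := mul_le_mul_of_nonneg_left (sum_range_exp_le ht R) (by positivity)
    _ = 7680 / κ ^ 4 := by field_simp; ring

/-! ## §2 The `P ∘ Qᵀ` leg: a translation-invariant leg against bounded block-supported weights, uniformly in the centres -/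

section Legs

variable {F : Pt → ℝ} {ω I : Pt → Pt → ℝ} {γ β : Pt → Pt} {A ω₀ ι κ : ℝ} {Rω : ℕ}

/-- [folklore] **QUADRATIC LEG**: `Σ_{x∈X} |F(b−x)|·ω x B ≤ 737·A·ω₀·(Rω+1)²`, uniformly in `b, B` (`0 ≤ ω ≤ ω₀`, `supp ω(·,B) ⊆ {‖x − γB‖∞ ≤ Rω}`). -/
theorem sum_leg_weight_le_sq (hF : ∀ z, |F z| ≤ A / ((supNorm z : ℝ) + 1) ^ 2)
    (hω0 : ∀ x B, 0 ≤ ω x B) (hω1 : ∀ x B, ω x B ≤ ω₀) (hωs : ∀ x B, ω x B ≠ 0 → supNorm (x - γ B) ≤ Rω)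
    (b B : Pt) (X : Finset Pt) :
    ∑ x ∈ X, |F (b - x)| * ω x B ≤ 737 * A * ω₀ * ((Rω : ℝ) + 1) ^ 2 := by
  classical
  have hA : 0 ≤ A := by
    have h := hF 0; rw [supNorm_eq_zero_iff.mpr rfl] at h; norm_num at h; exact (abs_nonneg _).trans h
  have hω₀ : 0 ≤ ω₀ := (hω0 b B).trans (hω1 b B)
  -- drop the points where `ω` vanishes, bound `ω ≤ ω₀` and `|F| ≤ A·(…)⁻²` on the rest
  set X' := X.filter (fun x => ω x B ≠ 0)
  have hsum : ∑ x ∈ X, |F (b - x)| * ω x B = ∑ x ∈ X', |F (b - x)| * ω x B := by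
    rw [Finset.sum_filter]
    refine Finset.sum_congr rfl fun x _ => ?_
    split_ifs with h
    · rfl
    · rw [not_not.mp h, mul_zero]
  rw [hsum]
  have hX' : ∀ z ∈ X'.image (fun x => b - x), supNorm (z - (b - γ B)) ≤ Rω := by
    intro z hz
    obtain ⟨x, hx, rfl⟩ := Finset.mem_image.mp hz
    have hx' := (Finset.mem_filter.mp hx).2
    have e : b - x - (b - γ B) = -(x - γ B) := by abel
    rw [e, supNorm_neg]; exact hωs x B hx'
  have hinj : Set.InjOn (fun x : Pt => b - x) X' := fun a _ c _ h => by simpa using h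
  calc ∑ x ∈ X', |F (b - x)| * ω x B ≤ ∑ x ∈ X', (A / ((supNorm (b - x) : ℝ) + 1) ^ 2) * ω₀ :=
        Finset.sum_le_sum fun x _ => mul_le_mul (hF _) (hω1 _ _) (hω0 _ _) (by positivity)
    _ = A * ω₀ * ∑ x ∈ X', (((supNorm (b - x) : ℝ) + 1) ^ 2)⁻¹ := by
        rw [Finset.mul_sum]; refine Finset.sum_congr rfl fun x _ => ?_; rw [div_eq_mul_inv]; ring
    _ = A * ω₀ * ∑ z ∈ X'.image (fun x => b - x), (((supNorm z : ℝ) + 1) ^ 2)⁻¹ := by rw [Finset.sum_image hinj]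
    _ ≤ A * ω₀ * (737 * ((Rω : ℝ) + 1) ^ 2) :=
        mul_le_mul_of_nonneg_left (sum_shifted_box_inv_sq_le Rω (b - γ B) _ hX') (by positivity)
    _ = _ := by ring

/-- [folklore] **CUBIC LEG** (the differenced `P`): `Σ_{x∈X} |F(b−x)|·ω x B ≤ 257·A·ω₀·(Rω+1)` — one power of the support radius better. -/
theorem sum_leg_weight_le_cube (hF : ∀ z, |F z| ≤ A / ((supNorm z : ℝ) + 1) ^ 3)
    (hω0 : ∀ x B, 0 ≤ ω x B) (hω1 : ∀ x B, ω x B ≤ ω₀) (hωs : ∀ x B, ω x B ≠ 0 → supNorm (x - γ B) ≤ Rω)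
    (b B : Pt) (X : Finset Pt) :
    ∑ x ∈ X, |F (b - x)| * ω x B ≤ 257 * A * ω₀ * ((Rω : ℝ) + 1) := by
  classical
  have hA : 0 ≤ A := by
    have h := hF 0; rw [supNorm_eq_zero_iff.mpr rfl] at h; norm_num at h; exact (abs_nonneg _).trans h
  have hω₀ : 0 ≤ ω₀ := (hω0 b B).trans (hω1 b B)
  set X' := X.filter (fun x => ω x B ≠ 0)
  have hsum : ∑ x ∈ X, |F (b - x)| * ω x B = ∑ x ∈ X', |F (b - x)| * ω x B := by
    rw [Finset.sum_filter]
    refine Finset.sum_congr rfl fun x _ => ?_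
    split_ifs with h
    · rfl
    · rw [not_not.mp h, mul_zero]
  rw [hsum]
  have hX' : ∀ z ∈ X'.image (fun x => b - x), supNorm (z - (b - γ B)) ≤ Rω := by
    intro z hz
    obtain ⟨x, hx, rfl⟩ := Finset.mem_image.mp hz
    have hx' := (Finset.mem_filter.mp hx).2
    have e : b - x - (b - γ B) = -(x - γ B) := by abel
    rw [e, supNorm_neg]; exact hωs x B hx'
  have hinj : Set.InjOn (fun x : Pt => b - x) X' := fun a _ c _ h => by simpa using h
  calc ∑ x ∈ X', |F (b - x)| * ω x B ≤ ∑ x ∈ X', (A / ((supNorm (b - x) : ℝ) + 1) ^ 3) * ω₀ :=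
        Finset.sum_le_sum fun x _ => mul_le_mul (hF _) (hω1 _ _) (hω0 _ _) (by positivity)
    _ = A * ω₀ * ∑ x ∈ X', (((supNorm (b - x) : ℝ) + 1) ^ 3)⁻¹ := by
        rw [Finset.mul_sum]; refine Finset.sum_congr rfl fun x _ => ?_; rw [div_eq_mul_inv]; ring
    _ = A * ω₀ * ∑ z ∈ X'.image (fun x => b - x), (((supNorm z : ℝ) + 1) ^ 3)⁻¹ := by rw [Finset.sum_image hinj]
    _ ≤ A * ω₀ * (257 * ((Rω : ℝ) + 1)) :=
        mul_le_mul_of_nonneg_left (sum_shifted_box_inv_cube_le Rω (b - γ B) _ hX') (by positivity)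
    _ = _ := by ring

/-! ## §3 Three factors: the `P ∘ Qᵀ` leg against the coarse × fine leg -/

/-- [folklore] **THREE FACTORS, finite currency**: if the `P ∘ Qᵀ` leg is `≤ L` uniformly in `(b, B)` (§2) and `|g B| ≤ ι·e^{−κ‖B − c‖∞}` (a column of the coarse leg),
then `Σ_{B∈𝔅}Σ_{x∈X} |F(b−x)|·ω x B·|g B| ≤ L·ι·(1 + 7680∕κ⁴)`. -/
theorem sum_three_le (hκ : 0 < κ) {b : Pt} {L : ℝ} (hL : ∀ (B : Pt) (X : Finset Pt), ∑ x ∈ X, |F (b - x)| * ω x B ≤ L)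
    (hω0 : ∀ x B, 0 ≤ ω x B) {g : Pt → ℝ} {c : Pt} (hg : ∀ B, |g B| ≤ ι * Real.exp (-(κ * (supNorm (B - c) : ℝ))))
    (Bs X : Finset Pt) :
    ∑ B ∈ Bs, ∑ x ∈ X, |F (b - x)| * ω x B * |g B| ≤ L * ι * (1 + 7680 / κ ^ 4) := by
  have hL0 : 0 ≤ L := le_trans (by simp) (hL c ∅)
  have hι : 0 ≤ ι := by
    have h := hg c; rw [sub_self, supNorm_eq_zero_iff.mpr rfl] at h; norm_num at h; exact (abs_nonneg _).trans h
  calc ∑ B ∈ Bs, ∑ x ∈ X, |F (b - x)| * ω x B * |g B| = ∑ B ∈ Bs, |g B| * ∑ x ∈ X, |F (b - x)| * ω x B := by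
        refine Finset.sum_congr rfl fun B _ => ?_
        rw [Finset.mul_sum]; exact Finset.sum_congr rfl fun x _ => by ring
    _ ≤ ∑ B ∈ Bs, (ι * Real.exp (-(κ * (supNorm (B - c) : ℝ)))) * L :=
        Finset.sum_le_sum fun B _ => mul_le_mul (hg B) (hL B X) (Finset.sum_nonneg fun x _ => mul_nonneg (abs_nonneg _) (hω0 _ _)) (by positivity)
    _ = L * ι * ∑ B ∈ Bs, Real.exp (-(κ * (supNorm (B - c) : ℝ))) := by rw [Finset.mul_sum]; exact Finset.sum_congr rfl fun B _ => by ring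
    _ ≤ L * ι * (1 + 7680 / κ ^ 4) := mul_le_mul_of_nonneg_left (sum_exp_coarse_le hκ c Bs) (by positivity)

/-- [folklore] uniform finite bounds on `Pt × Pt` (pairs `(x, B)`), hence summability and the `tsum` bound. -/
theorem sum_prod_three_le (hκ : 0 < κ) {b : Pt} {L : ℝ} (hL : ∀ (B : Pt) (X : Finset Pt), ∑ x ∈ X, |F (b - x)| * ω x B ≤ L)
    (hω0 : ∀ x B, 0 ≤ ω x B) {g : Pt → ℝ} {c : Pt} (hg : ∀ B, |g B| ≤ ι * Real.exp (-(κ * (supNorm (B - c) : ℝ))))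
    (U : Finset (Pt × Pt)) :
    ∑ xB ∈ U, |F (b - xB.1) * ω xB.1 xB.2 * g xB.2| ≤ L * ι * (1 + 7680 / κ ^ 4) := by
  classical
  have hsub : U ⊆ (U.image Prod.fst) ×ˢ (U.image Prod.snd) := fun xB h =>
    Finset.mem_product.mpr ⟨Finset.mem_image_of_mem _ h, Finset.mem_image_of_mem _ h⟩
  calc ∑ xB ∈ U, |F (b - xB.1) * ω xB.1 xB.2 * g xB.2|
      ≤ ∑ xB ∈ (U.image Prod.fst) ×ˢ (U.image Prod.snd), |F (b - xB.1) * ω xB.1 xB.2 * g xB.2| :=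
        Finset.sum_le_sum_of_subset_of_nonneg hsub fun _ _ _ => abs_nonneg _
    _ = ∑ B ∈ U.image Prod.snd, ∑ x ∈ U.image Prod.fst, |F (b - x)| * ω x B * |g B| := by
        rw [Finset.sum_product, Finset.sum_comm]
        refine Finset.sum_congr rfl fun B _ => Finset.sum_congr rfl fun x _ => ?_
        rw [abs_mul, abs_mul, abs_of_nonneg (hω0 _ _)]
    _ ≤ _ := sum_three_le hκ hL hω0 hg _ _

/-- [folklore] **SUMMABILITY** of the three-factor kernel on `ℤ⁴ × ℤ⁴`. -/
theorem summable_three (hκ : 0 < κ) {b : Pt} {L : ℝ} (hL : ∀ (B : Pt) (X : Finset Pt), ∑ x ∈ X, |F (b - x)| * ω x B ≤ L)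
    (hω0 : ∀ x B, 0 ≤ ω x B) {g : Pt → ℝ} {c : Pt} (hg : ∀ B, |g B| ≤ ι * Real.exp (-(κ * (supNorm (B - c) : ℝ)))) :
    Summable fun xB : Pt × Pt => F (b - xB.1) * ω xB.1 xB.2 * g xB.2 :=
  Summable.of_abs (summable_of_sum_le (fun _ => abs_nonneg _) (sum_prod_three_le hκ hL hω0 hg))

/-- [folklore] **THE THREE-FACTOR `tsum` BOUND**: `|Σ'_{(x,B)} F(b−x)·ω x B·g B| ≤ L·ι·(1 + 7680∕κ⁴)`. -/
theorem abs_tsum_three_le (hκ : 0 < κ) {b : Pt} {L : ℝ} (hL : ∀ (B : Pt) (X : Finset Pt), ∑ x ∈ X, |F (b - x)| * ω x B ≤ L)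
    (hω0 : ∀ x B, 0 ≤ ω x B) {g : Pt → ℝ} {c : Pt} (hg : ∀ B, |g B| ≤ ι * Real.exp (-(κ * (supNorm (B - c) : ℝ)))) :
    |∑' xB : Pt × Pt, F (b - xB.1) * ω xB.1 xB.2 * g xB.2| ≤ L * ι * (1 + 7680 / κ ^ 4) := by
  have habs : Summable fun xB : Pt × Pt => |F (b - xB.1) * ω xB.1 xB.2 * g xB.2| :=
    summable_of_sum_le (fun _ => abs_nonneg _) (sum_prod_three_le hκ hL hω0 hg)
  calc |∑' xB : Pt × Pt, F (b - xB.1) * ω xB.1 xB.2 * g xB.2| ≤ ∑' xB : Pt × Pt, |F (b - xB.1) * ω xB.1 xB.2 * g xB.2| := by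
        have h := norm_tsum_le_tsum_norm (f := fun xB : Pt × Pt => F (b - xB.1) * ω xB.1 xB.2 * g xB.2)
          (by simpa [Real.norm_eq_abs] using habs)
        simpa [Real.norm_eq_abs] using h
    _ ≤ _ := Real.tsum_le_of_sum_le (fun _ => abs_nonneg _) (sum_prod_three_le hκ hL hω0 hg)

/-! ## §4 The four RHOA-3 letters for `ρ₂ b w := Σ'_{(x,B)} F(b−x)·ω x B·I B w` -/

variable {A₀ A₁ ι₀ ι₁ : ℝ}

/-- [our object] **`hR0`**: `|ρ₂ b w| ≤ 737A₀ω₀(Rω+1)²·ι₀·(1 + 7680∕κ⁴)` (on the road `≍ n^{−4}·n²·1 = n^{−2}`). -/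
theorem abs_rho₂_le (hκ : 0 < κ) (hF : ∀ z, |F z| ≤ A₀ / ((supNorm z : ℝ) + 1) ^ 2)
    (hω0 : ∀ x B, 0 ≤ ω x B) (hω1 : ∀ x B, ω x B ≤ ω₀) (hωs : ∀ x B, ω x B ≠ 0 → supNorm (x - γ B) ≤ Rω)
    (hI0 : ∀ B w, |I B w| ≤ ι₀ * Real.exp (-(κ * (supNorm (B - β w) : ℝ)))) (b w : Pt) :
    |∑' xB : Pt × Pt, F (b - xB.1) * ω xB.1 xB.2 * I xB.2 w| ≤ 737 * A₀ * ω₀ * ((Rω : ℝ) + 1) ^ 2 * ι₀ * (1 + 7680 / κ ^ 4) :=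
  abs_tsum_three_le hκ (fun B X => sum_leg_weight_le_sq hF hω0 hω1 hωs b B X) hω0 (g := fun B => I B w) (hI0 · w)

/-- [our object] **`hR1`** — the `b`-difference lands on the translation-invariant leg, read with its CUBIC letter (`F′ z := F (z+u) − F z`):
`|ρ₂ (b+u) w − ρ₂ b w| ≤ 257A₁ω₀(Rω+1)·ι₀·(1 + 7680∕κ⁴)` (on the road `≍ n^{−4}·n = n^{−3}`). -/
theorem abs_rho₂_sub_left_le (hκ : 0 < κ) (hF : ∀ z, |F z| ≤ A₀ / ((supNorm z : ℝ) + 1) ^ 2) (u : Pt)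
    (hF1 : ∀ z, |F (z + u) - F z| ≤ A₁ / ((supNorm z : ℝ) + 1) ^ 3)
    (hω0 : ∀ x B, 0 ≤ ω x B) (hω1 : ∀ x B, ω x B ≤ ω₀) (hωs : ∀ x B, ω x B ≠ 0 → supNorm (x - γ B) ≤ Rω)
    (hI0 : ∀ B w, |I B w| ≤ ι₀ * Real.exp (-(κ * (supNorm (B - β w) : ℝ)))) (b w : Pt) :
    |(∑' xB : Pt × Pt, F (b + u - xB.1) * ω xB.1 xB.2 * I xB.2 w) - ∑' xB : Pt × Pt, F (b - xB.1) * ω xB.1 xB.2 * I xB.2 w|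
      ≤ 257 * A₁ * ω₀ * ((Rω : ℝ) + 1) * ι₀ * (1 + 7680 / κ ^ 4) := by
  have hsum1 : Summable fun xB : Pt × Pt => F (b + u - xB.1) * ω xB.1 xB.2 * I xB.2 w :=
    summable_three hκ (fun B X => sum_leg_weight_le_sq hF hω0 hω1 hωs (b + u) B X) hω0 (g := fun B => I B w) (hI0 · w)
  have hsum0 : Summable fun xB : Pt × Pt => F (b - xB.1) * ω xB.1 xB.2 * I xB.2 w :=
    summable_three hκ (fun B X => sum_leg_weight_le_sq hF hω0 hω1 hωs b B X) hω0 (g := fun B => I B w) (hI0 · w)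
  rw [← hsum1.tsum_sub hsum0]
  have e : (fun xB : Pt × Pt => F (b + u - xB.1) * ω xB.1 xB.2 * I xB.2 w - F (b - xB.1) * ω xB.1 xB.2 * I xB.2 w)
      = fun xB : Pt × Pt => (fun z => F (z + u) - F z) (b - xB.1) * ω xB.1 xB.2 * I xB.2 w := by
    funext xB; simp only; rw [show b - xB.1 + u = b + u - xB.1 by abel]; ring
  rw [e]
  exact abs_tsum_three_le hκ (F := fun z => F (z + u) - F z) (b := b) (fun B X => sum_leg_weight_le_cube hF1 hω0 hω1 hωs b B X) hω0
    (g := fun B => I B w) (hI0 · w)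

/-- [our object] **`hR1′`** — the `w`-difference lands on the coarse leg's fine variable (`|I B (w+v) − I B w| ≤ ι₁·e^{−κ‖B − β w‖∞}`):
`|ρ₂ b (w+v) − ρ₂ b w| ≤ 737A₀ω₀(Rω+1)²·ι₁·(1 + 7680∕κ⁴)` (on the road `ι₁ ≍ ι₀∕n`, letter `≍ n^{−3}`). -/
theorem abs_rho₂_sub_right_le (hκ : 0 < κ) (hF : ∀ z, |F z| ≤ A₀ / ((supNorm z : ℝ) + 1) ^ 2)
    (hω0 : ∀ x B, 0 ≤ ω x B) (hω1 : ∀ x B, ω x B ≤ ω₀) (hωs : ∀ x B, ω x B ≠ 0 → supNorm (x - γ B) ≤ Rω)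
    (hI0 : ∀ B w, |I B w| ≤ ι₀ * Real.exp (-(κ * (supNorm (B - β w) : ℝ)))) (v : Pt)
    (hI1 : ∀ B w, |I B (w + v) - I B w| ≤ ι₁ * Real.exp (-(κ * (supNorm (B - β w) : ℝ)))) (b w : Pt) :
    |(∑' xB : Pt × Pt, F (b - xB.1) * ω xB.1 xB.2 * I xB.2 (w + v)) - ∑' xB : Pt × Pt, F (b - xB.1) * ω xB.1 xB.2 * I xB.2 w|
      ≤ 737 * A₀ * ω₀ * ((Rω : ℝ) + 1) ^ 2 * ι₁ * (1 + 7680 / κ ^ 4) := by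
  have hsum1 : Summable fun xB : Pt × Pt => F (b - xB.1) * ω xB.1 xB.2 * I xB.2 (w + v) :=
    summable_three hκ (fun B X => sum_leg_weight_le_sq hF hω0 hω1 hωs b B X) hω0 (g := fun B => I B (w + v)) (hI0 · (w + v))
  have hsum0 : Summable fun xB : Pt × Pt => F (b - xB.1) * ω xB.1 xB.2 * I xB.2 w :=
    summable_three hκ (fun B X => sum_leg_weight_le_sq hF hω0 hω1 hωs b B X) hω0 (g := fun B => I B w) (hI0 · w)
  rw [← hsum1.tsum_sub hsum0]
  have e : (fun xB : Pt × Pt => F (b - xB.1) * ω xB.1 xB.2 * I xB.2 (w + v) - F (b - xB.1) * ω xB.1 xB.2 * I xB.2 w)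
      = fun xB : Pt × Pt => F (b - xB.1) * ω xB.1 xB.2 * (I xB.2 (w + v) - I xB.2 w) := by
    funext xB; ring
  rw [e]
  exact abs_tsum_three_le hκ (fun B X => sum_leg_weight_le_sq hF hω0 hω1 hωs b B X) hω0 (g := fun B => I B (w + v) - I B w) (hI1 · w)

/-- [our object] **`hR2`** — the mixed second difference: cubic letter on the translation-invariant leg, `ι₁` on the coarse leg:
`|ρ₂(b+u)(w+v) − ρ₂ b (w+v) − ρ₂ (b+u) w + ρ₂ b w| ≤ 257A₁ω₀(Rω+1)·ι₁·(1 + 7680∕κ⁴)` (on the road `≍ n^{−4}`). -/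
theorem abs_rho₂_sub_sub_le (hκ : 0 < κ) (hF : ∀ z, |F z| ≤ A₀ / ((supNorm z : ℝ) + 1) ^ 2) (u : Pt)
    (hF1 : ∀ z, |F (z + u) - F z| ≤ A₁ / ((supNorm z : ℝ) + 1) ^ 3)
    (hω0 : ∀ x B, 0 ≤ ω x B) (hω1 : ∀ x B, ω x B ≤ ω₀) (hωs : ∀ x B, ω x B ≠ 0 → supNorm (x - γ B) ≤ Rω)
    (hI0 : ∀ B w, |I B w| ≤ ι₀ * Real.exp (-(κ * (supNorm (B - β w) : ℝ)))) (v : Pt)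
    (hI1 : ∀ B w, |I B (w + v) - I B w| ≤ ι₁ * Real.exp (-(κ * (supNorm (B - β w) : ℝ)))) (b w : Pt) :
    |(∑' xB : Pt × Pt, F (b + u - xB.1) * ω xB.1 xB.2 * I xB.2 (w + v))
        - (∑' xB : Pt × Pt, F (b - xB.1) * ω xB.1 xB.2 * I xB.2 (w + v))
        - (∑' xB : Pt × Pt, F (b + u - xB.1) * ω xB.1 xB.2 * I xB.2 w)
        + ∑' xB : Pt × Pt, F (b - xB.1) * ω xB.1 xB.2 * I xB.2 w|
      ≤ 257 * A₁ * ω₀ * ((Rω : ℝ) + 1) * ι₁ * (1 + 7680 / κ ^ 4) := by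
  have hS := fun (b' : Pt) (w' : Pt) =>
    summable_three hκ (fun B X => sum_leg_weight_le_sq hF hω0 hω1 hωs b' B X) hω0 (g := fun B => I B w') (hI0 · w')
  rw [← (hS (b + u) (w + v)).tsum_sub (hS b (w + v)), ← ((hS (b + u) (w + v)).sub (hS b (w + v))).tsum_sub (hS (b + u) w),
    ← (((hS (b + u) (w + v)).sub (hS b (w + v))).sub (hS (b + u) w)).tsum_add (hS b w)]
  have e : (fun xB : Pt × Pt => F (b + u - xB.1) * ω xB.1 xB.2 * I xB.2 (w + v) - F (b - xB.1) * ω xB.1 xB.2 * I xB.2 (w + v)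
        - F (b + u - xB.1) * ω xB.1 xB.2 * I xB.2 w + F (b - xB.1) * ω xB.1 xB.2 * I xB.2 w)
      = fun xB : Pt × Pt => (fun z => F (z + u) - F z) (b - xB.1) * ω xB.1 xB.2 * (I xB.2 (w + v) - I xB.2 w) := by
    funext xB; simp only; rw [show b - xB.1 + u = b + u - xB.1 by abel]; ring
  rw [e]
  exact abs_tsum_three_le hκ (F := fun z => F (z + u) - F z) (b := b) (fun B X => sum_leg_weight_le_cube hF1 hω0 hω1 hωs b B X) hω0
    (g := fun B => I B (w + v) - I B w) (hI1 · w)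

end Legs

end Summit.QuantumFields.BalabanUV.Beta.FP.LegRemainderConstraintTerm

end
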